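import Literature.Probability.Percolation.CellSides
import Literature.Probability.Percolation.QuadCrossingSquareModel
import Literature.Probability.Percolation.QuadCrossingSpace
import HarnessLib

/-!
# The closed Jordan domain and the quad of a cell complex

Topic `Probability/Percolation`.  Third step of "a pinch-free hole-free finite union of closed unit
cells of `ℤ²` is a closed Jordan domain" (support for the quads of the gluing theorem,
Schramm–Smirnov 2011, proof of Thm 1.5).  With `K = ⋃_{c ∈ U} [c, c+1]²`:

* `frontier_Kset_subset` — the frontier of `K` lies on the closed segments of the boundary darts;
  `interior_Kset_disjoint_edgeSeg` — no interior point of `K` lies on a boundary edge;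
* `carrier_polygonDomain_traceList` — for an edge-connected pinch-free complex without holes the
  inside of the traced polygon (`polygonDomain`, `PolygonalDomains.lean`) is `interior K`, and its
  closure is `K` (`closure_carrier_eq_Kset`) — from `polygonDomain_carrier_eq` and the single-cycle
  theorem `exists_eq_bdOrbit_of_isBd`;
* `cellRect` — the complex with four marked traced vertices as a `ConformalRectangle`, its arcs
  as unions of traced edges (`arc_cellRect_eq`);
* `Quad.ofConformalRectangle` — any conformal rectangle whose closure lies in `D` read as a
  `Quad D` through a square model (`exists_isSquareModel`, Schoenflies), with
  `carrier = closure R.carrier` and `side k = R.arc (k + 3)`; `cellQuad` — the quad of the complex.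

Everything is proved; no named fact is introduced.

## References

* O. Schramm, S. Smirnov, Ann. Probab. 39 (2011), arXiv:1101.5820, proof of Thm 1.5. [SchrammSmirnov2011]
* Ch. Pommerenke, *Boundary Behaviour of Conformal Maps* (1992), §2.3 Cor. 2.9 (Schoenflies). [PommerenkeBBCM1992]
-/

noncomputable section

open Set Metric
open Literature.Probability.LatticeModels
open Literature.Probability.RandomPlanarGeometry
open Literature.Topology.PlaneTopology

namespace Literature.Probability.Percolation

namespace CellComplex

/-! ### The union of closed cells -/

/-- The closed unit cell with lower-left corner `c`. [folklore] -/
def sqCell (c : Site 2) : Set ℂ := Icc (c 0 : ℝ) (c 0 + 1) ×ℂ Icc (c 1 : ℝ) (c 1 + 1)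

/-- The open unit cell with lower-left corner `c`. [folklore] -/
def sqOpen (c : Site 2) : Set ℂ := Ioo (c 0 : ℝ) (c 0 + 1) ×ℂ Ioo (c 1 : ℝ) (c 1 + 1)

/-- The union of the closed cells of `U`. [folklore] -/
def Kset (U : Finset (Site 2)) : Set ℂ := ⋃ c ∈ U, sqCell c

/-- Closed cells are compact. [folklore] -/
theorem isCompact_sqCell (c : Site 2) : IsCompact (sqCell c) := isCompact_Icc.reProdIm isCompact_Icc

/-- Open cells are open. [folklore] -/
theorem isOpen_sqOpen (c : Site 2) : IsOpen (sqOpen c) := isOpen_Ioo.reProdIm isOpen_Ioo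

/-- The open cell lies in the closed cell. [folklore] -/
theorem sqOpen_subset_sqCell (c : Site 2) : sqOpen c ⊆ sqCell c := fun _ hp =>
  ⟨Ioo_subset_Icc_self hp.1, Ioo_subset_Icc_self hp.2⟩

/-- The closed cell is the closure of the open cell. [folklore] -/
theorem closure_sqOpen (c : Site 2) : closure (sqOpen c) = sqCell c := by
  rw [sqOpen, Complex.closure_reProdIm, closure_Ioo (by norm_num), closure_Ioo (by norm_num)]
  rfl

/-- `K` is compact. [folklore] -/
theorem isCompact_Kset (U : Finset (Site 2)) : IsCompact (Kset U) :=
  U.finite_toSet.isCompact_biUnion fun c _ => isCompact_sqCell c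

/-- `K` is closed. [folklore] -/
theorem isClosed_Kset (U : Finset (Site 2)) : IsClosed (Kset U) := (isCompact_Kset U).isClosed

/-- Cells of `U` lie in `K`. [folklore] -/
theorem sqCell_subset_Kset {U : Finset (Site 2)} {c : Site 2} (hc : c ∈ U) : sqCell c ⊆ Kset U :=
  subset_biUnion_of_mem (u := sqCell) hc

/-- Open cells of `U` lie in the interior of `K`. [folklore] -/
theorem sqOpen_subset_interior {U : Finset (Site 2)} {c : Site 2} (hc : c ∈ U) :
    sqOpen c ⊆ interior (Kset U) :=
  interior_maximal ((sqOpen_subset_sqCell c).trans (sqCell_subset_Kset hc)) (isOpen_sqOpen c)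

/-- An open cell meeting a closed cell has the same corner. [folklore] -/
theorem eq_of_sqOpen_inter_sqCell {c c' : Site 2} {p : ℂ} (hp : p ∈ sqOpen c) (hp' : p ∈ sqCell c') :
    c = c' := by
  rw [sqOpen, Complex.mem_reProdIm, mem_Ioo, mem_Ioo] at hp
  rw [sqCell, Complex.mem_reProdIm, mem_Icc, mem_Icc] at hp'
  obtain ⟨⟨h1, h2⟩, h3, h4⟩ := hp
  obtain ⟨⟨h1', h2'⟩, h3', h4'⟩ := hp'
  have e0 : c 0 = c' 0 := by
    have a : (c 0 : ℝ) < c' 0 + 1 := by linarith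
    have b : (c' 0 : ℝ) < c 0 + 1 := by linarith
    have a' : c 0 < c' 0 + 1 := by exact_mod_cast a
    have b' : c' 0 < c 0 + 1 := by exact_mod_cast b
    omega
  have e1 : c 1 = c' 1 := by
    have a : (c 1 : ℝ) < c' 1 + 1 := by linarith
    have b : (c' 1 : ℝ) < c 1 + 1 := by linarith
    have a' : c 1 < c' 1 + 1 := by exact_mod_cast a
    have b' : c' 1 < c 1 + 1 := by exact_mod_cast b
    omega
  funext i; fin_cases i <;> assumption

/-- The open cell of a cell outside `U` misses `K`. [folklore] -/
theorem sqOpen_disjoint_Kset {U : Finset (Site 2)} {o : Site 2} (ho : o ∉ U) :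
    Disjoint (sqOpen o) (Kset U) := by
  rw [Set.disjoint_left]
  intro p hp hpK
  rw [Kset, mem_iUnion₂] at hpK
  obtain ⟨c, hc, hpc⟩ := hpK
  exact ho (eq_of_sqOpen_inter_sqCell hp hpc ▸ hc)

/-- Every point lies in the closed cell of its floor. [folklore] -/
theorem mem_sqCell_floor (p : ℂ) : p ∈ sqCell (fun i => if i = 0 then ⌊p.re⌋ else ⌊p.im⌋) := by
  rw [sqCell, Complex.mem_reProdIm, mem_Icc, mem_Icc]
  simp only [Fin.isValue, ↓reduceIte, one_ne_zero]
  exact ⟨⟨Int.floor_le _, (Int.lt_floor_add_one _).le⟩, Int.floor_le _, (Int.lt_floor_add_one _).le⟩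

/-- The family of closed cells is locally finite. [folklore] -/
theorem locallyFinite_sqCell : LocallyFinite (fun c : Site 2 => sqCell c) := by
  intro p
  refine ⟨ball p 1, ball_mem_nhds p one_pos, ?_⟩
  -- cells meeting the ball have corner within `2` of the floor of `p`
  set a : ℤ := ⌊p.re⌋
  set b : ℤ := ⌊p.im⌋
  have hsub : {c : Site 2 | (sqCell c ∩ ball p 1).Nonempty} ⊆
      (fun q : ℤ × ℤ => (fun i : Fin 2 => if i = 0 then q.1 else q.2)) ''
        ((Finset.Icc (a - 2) (a + 2) ×ˢ Finset.Icc (b - 2) (b + 2) : Finset (ℤ × ℤ)) : Set (ℤ × ℤ)) := by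
    intro c hc
    obtain ⟨q, hqc, hqp⟩ := hc
    rw [sqCell, Complex.mem_reProdIm, mem_Icc, mem_Icc] at hqc
    rw [mem_ball, Complex.dist_eq] at hqp
    have hre : |q.re - p.re| < 1 := lt_of_le_of_lt (Complex.abs_re_le_norm (q - p) |>.trans_eq' (by simp)) hqp
    have him : |q.im - p.im| < 1 := lt_of_le_of_lt (Complex.abs_im_le_norm (q - p) |>.trans_eq' (by simp)) hqp
    rw [abs_lt] at hre him
    have ha1 : (a : ℝ) ≤ p.re := Int.floor_le _
    have ha2 : p.re < a + 1 := Int.lt_floor_add_one _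
    have hb1 : (b : ℝ) ≤ p.im := Int.floor_le _
    have hb2 : p.im < b + 1 := Int.lt_floor_add_one _
    refine ⟨(c 0, c 1), ?_, by funext i; fin_cases i <;> simp⟩
    simp only [Finset.coe_product, Finset.coe_Icc, mem_prod, mem_Icc]
    have h0l : (a : ℝ) - 2 < c 0 + 1 := by linarith [hqc.1.2]
    have h0u : (c 0 : ℝ) < a + 2 := by linarith [hqc.1.1]
    have h1l : (b : ℝ) - 2 < c 1 + 1 := by linarith [hqc.2.2]
    have h1u : (c 1 : ℝ) < b + 2 := by linarith [hqc.2.1]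
    have h0l' : a - 2 < c 0 + 1 := by exact_mod_cast h0l
    have h0u' : c 0 < a + 2 := by exact_mod_cast h0u
    have h1l' : b - 2 < c 1 + 1 := by exact_mod_cast h1l
    have h1u' : c 1 < b + 2 := by exact_mod_cast h1u
    refine ⟨⟨?_, ?_⟩, ?_, ?_⟩ <;> omega
  exact (Set.Finite.image _ (Finset.finite_toSet _)).subset hsub

/-- The complement of `K` is covered by the closed cells of the cells outside `U`. [folklore] -/
theorem compl_Kset_subset (U : Finset (Site 2)) : (Kset U)ᶜ ⊆ ⋃ o ∈ (↑U : Set (Site 2))ᶜ, sqCell o := by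
  intro p hp
  rw [mem_iUnion₂]
  refine ⟨_, fun ho => hp (sqCell_subset_Kset ho (mem_sqCell_floor p)), mem_sqCell_floor p⟩

/-- The union of the closed cells outside `U` is closed. [folklore] -/
theorem isClosed_iUnion_sqCell_compl (U : Finset (Site 2)) : IsClosed (⋃ o ∈ (↑U : Set (Site 2))ᶜ, sqCell o) := by
  have : (⋃ o ∈ (↑U : Set (Site 2))ᶜ, sqCell o) = ⋃ o : {o : Site 2 // o ∉ U}, sqCell o.1 := by
    ext p; simp only [mem_iUnion, mem_compl_iff, Finset.mem_coe, exists_prop, Subtype.exists]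
  rw [this]
  exact (locallyFinite_sqCell.comp_injective Subtype.val_injective).isClosed_iUnion
    fun o => (isCompact_sqCell _).isClosed

/-! ### Two closed cells meeting: shared edge or shared corner -/

/-- The four cells around a vertex contain the vertex. [folklore] -/
theorem toC_mem_sqCell_faceAt (q : Site 2) (j : Fin 4) : Site.toComplex q ∈ sqCell (faceAt q j) := by
  rw [sqCell, Complex.mem_reProdIm, mem_Icc, mem_Icc, Site.toComplex_re, Site.toComplex_im]
  fin_cases j <;> simp [faceAt, cornerOff]

/-- The reversed dart of `(q, k)`. [folklore] -/
theorem isBd_rev {U : Finset (Site 2)} {q : Site 2} {k : Fin 4} (h1 : faceAt q k ∉ U)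
    (h2 : faceAt q (k + 3) ∈ U) : IsBd U (q + cornerUnit k, k + 2) :=
  ⟨by show faceAt (q + cornerUnit k) (k + 2) ∈ U; rw [faceAt_add_unit_add_two]; exact h2,
   by show faceAt (q + cornerUnit k) (k + 2 + 3) ∉ U; rw [fin4_add_two_add_three, faceAt_add_unit_succ]; exact h1⟩

/-- The reversed edge has the same segment. [folklore] -/
theorem mem_edgeSeg_rev {q : Site 2} {k : Fin 4} {p : ℂ} (hp : p ∈ edgeSeg q k) :
    p ∈ edgeSeg (q + cornerUnit k) (k + 2) := by
  show p ∈ segment ℝ (Site.toComplex (q + cornerUnit k)) (Site.toComplex (q + cornerUnit k + cornerUnit (k + 2)))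
  rw [cornerUnit_add_two, show q + cornerUnit k + -cornerUnit k = q by abel, segment_symm]
  exact hp

/-- A cell having `q` as a corner is one of the four cells around `q`. [folklore] -/
theorem exists_faceAt_of_corner {q c : Site 2} (h0 : c 0 = q 0 ∨ c 0 = q 0 - 1)
    (h1 : c 1 = q 1 ∨ c 1 = q 1 - 1) : ∃ j : Fin 4, c = faceAt q j := by
  refine exists_faceAt_of_isCorner (fun i => ?_)
  fin_cases i
  · rcases h0 with h | h
    · exact Or.inl h.symm
    · exact Or.inr (by simp only [Fin.zero_eta, Fin.isValue]; omega)
  · rcases h1 with h | h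
    · exact Or.inl h.symm
    · exact Or.inr (by simp only [Fin.mk_one, Fin.isValue]; omega)

/-- Around a vertex with a cell in `U` and a cell outside `U` there is a transition. [folklore] -/
theorem exists_transition {U : Finset (Site 2)} (q : Site 2) {j₁ j₂ : Fin 4} (h1 : faceAt q j₁ ∈ U)
    (h2 : faceAt q j₂ ∉ U) : ∃ j : Fin 4, faceAt q j ∈ U ∧ faceAt q (j + 1) ∉ U := by
  by_contra hno
  push Not at hno
  have step : ∀ j, faceAt q j ∈ U → faceAt q (j + 1) ∈ U := fun j hj => hno j hj
  have hall : ∀ i : Fin 4, faceAt q (j₁ + i) ∈ U := by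
    intro i
    fin_cases i
    · simpa using h1
    · exact step _ h1
    · have := step _ (step _ h1); rwa [fin4_add_one_add_one] at this
    · have := step _ (step _ (step _ h1)); rwa [fin4_add_one_add_one, fin4_add_one_add_two] at this
  obtain ⟨i, hi⟩ := fin4_exists_add j₁ j₂
  exact h2 (hi ▸ hall i)

/-- At a vertex `q` around which some cell is in `U` and some is not, `q` is an endpoint of a
boundary edge. [folklore] -/
theorem exists_isBd_of_vertex {U : Finset (Site 2)} (q : Site 2) {j₁ j₂ : Fin 4} (h1 : faceAt q j₁ ∈ U)
    (h2 : faceAt q j₂ ∉ U) : ∃ d : Site 2 × Fin 4, IsBd U d ∧ Site.toComplex q ∈ edgeSeg d.1 d.2 := by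
  obtain ⟨j, hj, hj'⟩ := exists_transition q h1 h2
  -- the edge at `q` in direction `j + 1` separates `faceAt q (j+1)` (left) from `faceAt q j` (right)
  refine ⟨(q + cornerUnit (j + 1), j + 1 + 2), isBd_rev hj' (by rw [fin4_add_one_add_three]; exact hj), ?_⟩
  exact mem_edgeSeg_rev (left_mem_segment _ _ _)

/-- If a closed cell of `U` and a closed cell outside `U` meet at `p`, then `p` lies on the closed
segment of some boundary dart. [folklore] -/
theorem exists_isBd_of_mem_sqCell_inter {U : Finset (Site 2)} {c o : Site 2} (hc : c ∈ U) (ho : o ∉ U)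
    {p : ℂ} (hpc : p ∈ sqCell c) (hpo : p ∈ sqCell o) :
    ∃ d : Site 2 × Fin 4, IsBd U d ∧ p ∈ edgeSeg d.1 d.2 := by
  classical
  rw [sqCell, Complex.mem_reProdIm, mem_Icc, mem_Icc] at hpc hpo
  have hco : c ≠ o := fun h => ho (h ▸ hc)
  have hx : c 0 - 1 ≤ o 0 ∧ o 0 ≤ c 0 + 1 :=
    ⟨by have : (c 0 : ℝ) - 1 ≤ o 0 := by linarith [hpc.1.1, hpo.1.2]
        exact_mod_cast this,
     by have : (o 0 : ℝ) ≤ c 0 + 1 := by linarith [hpc.1.2, hpo.1.1]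
        exact_mod_cast this⟩
  have hy : c 1 - 1 ≤ o 1 ∧ o 1 ≤ c 1 + 1 :=
    ⟨by have : (c 1 : ℝ) - 1 ≤ o 1 := by linarith [hpc.2.1, hpo.2.2]
        exact_mod_cast this,
     by have : (o 1 : ℝ) ≤ c 1 + 1 := by linarith [hpc.2.2, hpo.2.1]
        exact_mod_cast this⟩
  have site_eq : ∀ (w w' : Site 2), w 0 = w' 0 → w 1 = w' 1 → w = w' := by
    intro w w' ha hb; funext i; fin_cases i <;> assumption
  -- membership of `p` in horizontal / vertical unit edges from coordinates
  have segH : ∀ (q : Site 2), p.im = q 1 → (q 0 : ℝ) ≤ p.re → p.re ≤ q 0 + 1 → p ∈ edgeSeg q 0 := by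
    intro q h1 h2 h3
    rw [edgeSeg, segment_eq_image_lineMap]
    refine ⟨p.re - q 0, ⟨by linarith, by linarith⟩, ?_⟩
    apply Complex.ext
    · simp [AffineMap.lineMap_apply_module', toComplex_add, toComplex_cornerUnit_table]
    · simp [AffineMap.lineMap_apply_module', toComplex_add, toComplex_cornerUnit_table, h1]
  have segV : ∀ (q : Site 2), p.re = q 0 → (q 1 : ℝ) ≤ p.im → p.im ≤ q 1 + 1 → p ∈ edgeSeg q 1 := by
    intro q h1 h2 h3
    rw [edgeSeg, segment_eq_image_lineMap]
    refine ⟨p.im - q 1, ⟨by linarith, by linarith⟩, ?_⟩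
    apply Complex.ext
    · simp [AffineMap.lineMap_apply_module', toComplex_add, toComplex_cornerUnit_table, h1]
    · simp [AffineMap.lineMap_apply_module', toComplex_add, toComplex_cornerUnit_table]
  have face0 : ∀ q : Site 2, faceAt q 0 = q := fun q => by simp [faceAt, cornerOff]
  have face1 : ∀ q : Site 2, (faceAt q 1) 0 = q 0 - 1 ∧ (faceAt q 1) 1 = q 1 := fun q => by
    simp [faceAt, cornerOff]
  have face3 : ∀ q : Site 2, (faceAt q 3) 0 = q 0 ∧ (faceAt q 3) 1 = q 1 - 1 := fun q => by
    simp [faceAt, cornerOff]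
  by_cases h0 : c 0 = o 0
  · -- horizontal common edge at height `Y = max (c 1) (o 1)`
    have h1 : c 1 ≠ o 1 := fun h1 => hco (site_eq c o h0 h1)
    rcases (show o 1 = c 1 + 1 ∨ o 1 = c 1 - 1 by omega) with hy1 | hy1
    · -- `o` above `c`: edge from `q = (c 0, c 1 + 1)` eastwards, left `q = o`, right `c`
      set q : Site 2 := fun i => if i = 0 then c 0 else c 1 + 1 with hq
      have hpim : p.im = c 1 + 1 := by
        have : (o 1 : ℝ) = c 1 + 1 := by exact_mod_cast hy1
        linarith [hpc.2.2, hpo.2.1]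
      have hqo : faceAt q 0 = o := by rw [face0]; exact site_eq q o (by simp [hq, h0]) (by simp [hq, hy1])
      have hqc : faceAt q 3 = c := site_eq _ c (by rw [(face3 q).1]; simp [hq]) (by rw [(face3 q).2]; simp [hq])
      refine ⟨(q + cornerUnit 0, 0 + 2), isBd_rev (by rw [hqo]; exact ho) (by rw [show (0:Fin 4) + 3 = 3 from rfl, hqc]; exact hc), ?_⟩
      exact mem_edgeSeg_rev (segH q (by simp [hq, hpim]) (by simp [hq]; exact hpc.1.1) (by simp [hq]; exact hpc.1.2))
    · -- `o` below `c`: edge from `q = c` eastwards, left `c`, right `o`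
      have hpim : p.im = c 1 := by
        have : (o 1 : ℝ) = c 1 - 1 := by exact_mod_cast hy1
        linarith [hpc.2.1, hpo.2.2]
      have hco' : faceAt c 3 = o := site_eq _ o (by rw [(face3 c).1, h0]) (by rw [(face3 c).2, hy1])
      refine ⟨(c, 0), ⟨by show faceAt c 0 ∈ U; rw [face0]; exact hc,
        by show faceAt c (0 + 3) ∉ U; rw [show (0:Fin 4) + 3 = 3 from rfl, hco']; exact ho⟩, ?_⟩
      exact segH c hpim hpc.1.1 hpc.1.2
  · rcases (show o 0 = c 0 + 1 ∨ o 0 = c 0 - 1 by omega) with hx1 | hx1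
    · -- `o` to the right of `c`: `p.re = c 0 + 1`
      have hpre : p.re = c 0 + 1 := by
        have : (o 0 : ℝ) = c 0 + 1 := by exact_mod_cast hx1
        linarith [hpc.1.2, hpo.1.1]
      by_cases h1 : c 1 = o 1
      · -- common vertical edge from `q = (c 0 + 1, c 1)` upwards: left `faceAt q 1 = c`, right `q = o`
        set q : Site 2 := fun i => if i = 0 then c 0 + 1 else c 1 with hq
        have hqc : faceAt q 1 = c := site_eq _ c (by rw [(face1 q).1]; simp [hq]) (by rw [(face1 q).2]; simp [hq])
        have hqo : faceAt q 0 = o := by rw [face0]; exact site_eq q o (by simp [hq, hx1]) (by simp [hq, h1])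
        refine ⟨(q, 1), ⟨by show faceAt q 1 ∈ U; rw [hqc]; exact hc,
          by show faceAt q (1 + 3) ∉ U; rw [show (1:Fin 4) + 3 = 0 from rfl, hqo]; exact ho⟩, ?_⟩
        exact segV q (by simp [hq, hpre]) (by simp [hq]; exact hpc.2.1) (by simp [hq]; exact hpc.2.2)
      · -- diagonal: `p` is a common corner
        rcases (show o 1 = c 1 + 1 ∨ o 1 = c 1 - 1 by omega) with hy1 | hy1
        · have hpim : p.im = c 1 + 1 := by
            have : (o 1 : ℝ) = c 1 + 1 := by exact_mod_cast hy1
            linarith [hpc.2.2, hpo.2.1]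
          set q : Site 2 := fun i => if i = 0 then c 0 + 1 else c 1 + 1 with hq
          have hpq : p = Site.toComplex q := Complex.ext (by simp [hq, hpre]) (by simp [hq, hpim])
          obtain ⟨j₁, hj₁⟩ := exists_faceAt_of_corner (q := q) (c := c) (Or.inr (by simp [hq])) (Or.inr (by simp [hq]))
          obtain ⟨j₂, hj₂⟩ := exists_faceAt_of_corner (q := q) (c := o) (Or.inl (by simp [hq, hx1])) (Or.inl (by simp [hq, hy1]))
          rw [hpq]
          exact exists_isBd_of_vertex q (hj₁ ▸ hc) (hj₂ ▸ ho)
        · have hpim : p.im = c 1 := by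
            have : (o 1 : ℝ) = c 1 - 1 := by exact_mod_cast hy1
            linarith [hpc.2.1, hpo.2.2]
          set q : Site 2 := fun i => if i = 0 then c 0 + 1 else c 1 with hq
          have hpq : p = Site.toComplex q := Complex.ext (by simp [hq, hpre]) (by simp [hq, hpim])
          obtain ⟨j₁, hj₁⟩ := exists_faceAt_of_corner (q := q) (c := c) (Or.inr (by simp [hq])) (Or.inl (by simp [hq]))
          obtain ⟨j₂, hj₂⟩ := exists_faceAt_of_corner (q := q) (c := o) (Or.inl (by simp [hq, hx1])) (Or.inr (by simp [hq, hy1]))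
          rw [hpq]
          exact exists_isBd_of_vertex q (hj₁ ▸ hc) (hj₂ ▸ ho)
    · -- `o` to the left of `c`: `p.re = c 0`
      have hpre : p.re = c 0 := by
        have : (o 0 : ℝ) = c 0 - 1 := by exact_mod_cast hx1
        linarith [hpc.1.1, hpo.1.2]
      by_cases h1 : c 1 = o 1
      · -- vertical edge from `q = c` upwards: left `faceAt c 1 = o`, right `c`; reversed dart
        have hco' : faceAt c 1 = o := site_eq _ o (by rw [(face1 c).1, hx1]) (by rw [(face1 c).2, h1])
        refine ⟨(c + cornerUnit 1, 1 + 2), isBd_rev (by rw [hco']; exact ho)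
          (by rw [show (1:Fin 4) + 3 = 0 from rfl, face0]; exact hc), ?_⟩
        exact mem_edgeSeg_rev (segV c hpre hpc.2.1 hpc.2.2)
      · rcases (show o 1 = c 1 + 1 ∨ o 1 = c 1 - 1 by omega) with hy1 | hy1
        · have hpim : p.im = c 1 + 1 := by
            have : (o 1 : ℝ) = c 1 + 1 := by exact_mod_cast hy1
            linarith [hpc.2.2, hpo.2.1]
          set q : Site 2 := fun i => if i = 0 then c 0 else c 1 + 1 with hq
          have hpq : p = Site.toComplex q := Complex.ext (by simp [hq, hpre]) (by simp [hq, hpim])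
          obtain ⟨j₁, hj₁⟩ := exists_faceAt_of_corner (q := q) (c := c) (Or.inl (by simp [hq])) (Or.inr (by simp [hq]))
          obtain ⟨j₂, hj₂⟩ := exists_faceAt_of_corner (q := q) (c := o) (Or.inr (by simp [hq, hx1])) (Or.inl (by simp [hq, hy1]))
          rw [hpq]
          exact exists_isBd_of_vertex q (hj₁ ▸ hc) (hj₂ ▸ ho)
        · have hpim : p.im = c 1 := by
            have : (o 1 : ℝ) = c 1 - 1 := by exact_mod_cast hy1
            linarith [hpc.2.1, hpo.2.2]
          set q : Site 2 := fun i => if i = 0 then c 0 else c 1 with hq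
          have hpq : p = Site.toComplex q := Complex.ext (by simp [hq, hpre]) (by simp [hq, hpim])
          obtain ⟨j₁, hj₁⟩ := exists_faceAt_of_corner (q := q) (c := c) (Or.inl (by simp [hq])) (Or.inl (by simp [hq]))
          obtain ⟨j₂, hj₂⟩ := exists_faceAt_of_corner (q := q) (c := o) (Or.inr (by simp [hq, hx1])) (Or.inr (by simp [hq, hy1]))
          rw [hpq]
          exact exists_isBd_of_vertex q (hj₁ ▸ hc) (hj₂ ▸ ho)

/-- **The frontier of `K` lies on the boundary edges.** [folklore] -/
theorem frontier_Kset_subset (U : Finset (Site 2)) :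
    frontier (Kset U) ⊆ ⋃ d ∈ {d : Site 2 × Fin 4 | IsBd U d}, edgeSeg d.1 d.2 := by
  intro p hp
  rw [frontier, (isClosed_Kset U).closure_eq] at hp
  obtain ⟨hpK, hpint⟩ := hp
  -- `p` is in the closure of the complement, hence in a closed cell outside `U`
  have hpcl : p ∈ closure (Kset U)ᶜ := by
    rw [closure_compl, mem_compl_iff]; exact hpint
  have hpO : p ∈ ⋃ o ∈ (↑U : Set (Site 2))ᶜ, sqCell o :=
    (isClosed_iUnion_sqCell_compl U).closure_subset_iff.2 (compl_Kset_subset U) hpcl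
  rw [mem_iUnion₂] at hpO
  obtain ⟨o, ho, hpo⟩ := hpO
  rw [Kset, mem_iUnion₂] at hpK
  obtain ⟨c, hc, hpc⟩ := hpK
  obtain ⟨d, hd, hpd⟩ := exists_isBd_of_mem_sqCell_inter hc ho hpc hpo
  exact mem_iUnion₂.2 ⟨d, hd, hpd⟩

/-- **No interior point of `K` lies on a boundary edge.** [folklore] -/
theorem interior_Kset_disjoint_edgeSeg {U : Finset (Site 2)} {d : Site 2 × Fin 4} (hd : IsBd U d) :
    Disjoint (interior (Kset U)) (edgeSeg d.1 d.2) := by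
  rw [Set.disjoint_left]
  intro p hp hpe
  -- `p` lies in the closed cell of the outer cell `o = faceAt v (k+3)`, the closure of its open cell
  obtain ⟨v, k⟩ := d
  set o := faceAt v (k + 3)
  have ho : o ∉ U := hd.2
  have hpo : p ∈ sqCell o := by
    obtain ⟨t, ht0, ht1, rfl⟩ := exists_of_mem_edgeSeg hpe
    rw [sqCell, Complex.mem_reProdIm, mem_Icc, mem_Icc]
    simp only [Complex.add_re, Complex.add_im, Complex.mul_re, Complex.mul_im, Complex.ofReal_re,
      Complex.ofReal_im, zero_mul, sub_zero, add_zero]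
    rw [Site.toComplex_re v, Site.toComplex_im v]
    have h0 : ((o 0 : ℤ) : ℝ) = v 0 + (match k with | 0 => 0 | 1 => 0 | 2 => -1 | 3 => -1 : ℝ) := by
      simp only [o]; fin_cases k <;> simp [faceAt, cornerOff] <;> ring
    have h1 : ((o 1 : ℤ) : ℝ) = v 1 + (match k with | 0 => -1 | 1 => 0 | 2 => 0 | 3 => -1 : ℝ) := by
      simp only [o]; fin_cases k <;> simp [faceAt, cornerOff] <;> ring
    rw [h0, h1]
    fin_cases k <;> norm_num [toComplex_cornerUnit_table] <;> constructor <;> linarith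
  rw [← closure_sqOpen] at hpo
  -- the open set `interior K` meets `sqOpen o`, which misses `K`
  obtain ⟨q, hqint, hqo⟩ : (interior (Kset U) ∩ sqOpen o).Nonempty :=
    mem_closure_iff.1 hpo _ isOpen_interior hp
  exact Set.disjoint_left.1 (sqOpen_disjoint_Kset ho) hqo (interior_subset hqint)


/-! ### The inside of the traced polygon is the interior of `K` -/

section Identification

variable {U : Finset (Site 2)} {d₀ : Site 2 × Fin 4} (h₀ : IsBd U d₀)

/-- The Jordan domain bounded by the traced polygon. [folklore] -/
def cellDomain (hP : PinchFree U) : JordanDomain :=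
  polygonDomain (traceList U d₀ h₀) (isSimpleClosedPolygon_traceList h₀ hP)

/-- Its boundary loop is the traced loop. [folklore] -/
@[simp] theorem cellDomain_boundary (hP : PinchFree U) : (cellDomain h₀ hP).boundary = bdLoop U d₀ h₀ := rfl

/-- Its frontier is the range of the traced loop. [folklore] -/
theorem frontier_cellDomain (hP : PinchFree U) : frontier (cellDomain h₀ hP).carrier = range (bdLoop U d₀ h₀) :=
  frontier_polygonDomain_eq_range _ _

/-- Under the single-cycle hypotheses the boundary edges are exactly the traced edges, so their
union is the range of the loop. [folklore] -/
theorem iUnion_edgeSeg_isBd_eq_range (hP : PinchFree U) (hE : EdgeConn U) (hH : CoHoleFree U) :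
    (⋃ d ∈ {d : Site 2 × Fin 4 | IsBd U d}, edgeSeg d.1 d.2) = range (bdLoop U d₀ h₀) := by
  apply Subset.antisymm
  · intro p hp
    rw [mem_iUnion₂] at hp
    obtain ⟨d, hd, hpd⟩ := hp
    obtain ⟨i, hi, rfl⟩ := exists_eq_bdOrbit_of_isBd h₀ hP hE hH hd
    exact edgeSeg_subset_range h₀ hi hpd
  · intro p hp
    obtain ⟨i, -, hpi⟩ := exists_edge_of_mem_range h₀ hp
    exact mem_iUnion₂.2 ⟨bdOrbit U d₀ i, isBd_bdOrbit h₀ i, hpi⟩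

/-- **The inside of the traced polygon is the interior of `K`.** [folklore] -/
theorem carrier_cellDomain (hP : PinchFree U) (hE : EdgeConn U) (hH : CoHoleFree U) :
    (cellDomain h₀ hP).carrier = interior (Kset U) := by
  have hne : U.Nonempty := ⟨_, h₀.1⟩
  obtain ⟨c, hc⟩ := hne
  refine polygonDomain_carrier_eq _ _ isOpen_interior ((isCompact_Kset U).isBounded.subset interior_subset)
    ?_ ?_ ?_
  · -- nonempty: the centre of a cell of `U`
    refine ⟨ctr c, sqOpen_subset_interior hc ?_⟩
    rw [sqOpen, Complex.mem_reProdIm, mem_Ioo, mem_Ioo, ctr_re, ctr_im]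
    refine ⟨⟨by linarith, by linarith⟩, by linarith, by linarith⟩
  · -- frontier
    calc frontier (interior (Kset U)) ⊆ frontier (Kset U) := frontier_interior_subset
      _ ⊆ ⋃ d ∈ {d : Site 2 × Fin 4 | IsBd U d}, edgeSeg d.1 d.2 := frontier_Kset_subset U
      _ = range (polygonLoop (traceList U d₀ h₀)) := iUnion_edgeSeg_isBd_eq_range h₀ hP hE hH
  · rw [Set.disjoint_left]
    intro p hp hpr
    obtain ⟨i, -, hpi⟩ := exists_edge_of_mem_range h₀ hpr
    exact Set.disjoint_left.1 (interior_Kset_disjoint_edgeSeg (isBd_bdOrbit h₀ i)) hp hpi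

/-- `K` is the closure of its interior. [folklore] -/
theorem closure_interior_Kset (U : Finset (Site 2)) : closure (interior (Kset U)) = Kset U := by
  apply Subset.antisymm
  · exact (closure_mono interior_subset).trans (isClosed_Kset U).closure_eq.subset
  · intro p hp
    rw [Kset, mem_iUnion₂] at hp
    obtain ⟨c, hc, hpc⟩ := hp
    rw [← closure_sqOpen] at hpc
    exact closure_mono (sqOpen_subset_interior hc) hpc

/-- **The closed domain of the traced polygon is `K`.** [folklore] -/
theorem closure_carrier_cellDomain (hP : PinchFree U) (hE : EdgeConn U) (hH : CoHoleFree U) :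
    closure (cellDomain h₀ hP).carrier = Kset U := by
  rw [carrier_cellDomain h₀ hP hE hH, closure_interior_Kset]

end Identification

/-! ### The marked domain of a cell complex and its arcs -/

section Marked

variable {U : Finset (Site 2)} {d₀ : Site 2 × Fin 4} (h₀ : IsBd U d₀) (hP : PinchFree U)

/-- **The cell complex with four marked traced vertices** `vert (a k)`, `0 = a 0 < a 1 < a 2 < a 3 < P`,
as a conformal rectangle (marks `a k / P`). [folklore] -/
def cellRect (a : Fin 4 → ℕ) (hmono : StrictMono a) (ha3 : a 3 < period h₀) :
    ConformalRectangle where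
  toJordanDomain := cellDomain h₀ hP
  mark k := a k / period h₀
  strictMono_mark := by
    intro i j hij
    have hP0 : (0 : ℝ) < period h₀ := by exact_mod_cast period_pos h₀
    exact div_lt_div_of_pos_right (by exact_mod_cast hmono hij) hP0
  mark_mem := by
    intro k
    have hP0 : (0 : ℝ) < period h₀ := by exact_mod_cast period_pos h₀
    have hk : a k ≤ a 3 := hmono.monotone (Fin.le_last k |>.trans_eq (by rfl))
    refine ⟨div_nonneg (by positivity) hP0.le, (div_lt_one hP0).2 ?_⟩
    exact_mod_cast hk.trans_lt ha3

/-- The image of a parameter interval between two traced vertices is the union of the traced edges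
between them. [folklore] -/
theorem image_bdLoop_Icc {m n : ℕ} (hmn : m ≤ n) (hn : n ≤ period h₀) :
    bdLoop U d₀ h₀ '' Icc ((m : ℝ) / period h₀) ((n : ℝ) / period h₀) =
      (⋃ j ∈ Ico m n, edgeSeg (vert U d₀ j) (dirAt U d₀ j)) ∪ {Site.toComplex (vert U d₀ n)} := by
  have hP0 : (0 : ℝ) < period h₀ := by exact_mod_cast period_pos h₀
  have hvertex : ∀ j ≤ period h₀, bdLoop U d₀ h₀ ((j : ℝ) / period h₀) = Site.toComplex (vert U d₀ j) := by
    intro j hj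
    rcases hj.lt_or_eq with hj | rfl
    · have := bdLoop_apply_div h₀ hj (θ := 0) ⟨le_rfl, zero_le_one⟩
      simpa using this
    · rw [div_self hP0.ne', bdLoop, (periodic_polygonLoop _).eq]
      have := polygonLoop_vertex (l := traceList U d₀ h₀) (k := 0) (by simpa using period_pos h₀)
      rw [getElem_traceList] at this
      simpa [vert_mod h₀ (period h₀)] using (show polygonLoop (traceList U d₀ h₀) 0 = Site.toComplex (vert U d₀ (period h₀)) by
        rw [show (0 : ℝ) = (0 : ℕ) / (traceList U d₀ h₀).length by simp, this, ← vert_mod h₀ (period h₀)]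
        simp)
  apply Subset.antisymm
  · rintro _ ⟨t, ht, rfl⟩
    rcases ht.2.lt_or_eq with htlt | rfl
    · -- `t < n/P`: on the edge `⌊tP⌋`
      left
      set sP : ℝ := t * period h₀ with hsP
      have hs0 : (m : ℝ) ≤ sP := by rw [hsP]; have := ht.1; rwa [div_le_iff₀ hP0] at this
      have hsn : sP < n := by rw [hsP]; rwa [lt_div_iff₀ hP0] at htlt
      set j : ℕ := ⌊sP⌋₊ with hj
      have hsP0 : 0 ≤ sP := le_trans (by positivity) hs0
      have hjs : (j : ℝ) ≤ sP := Nat.floor_le hsP0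
      have hsj : sP < j + 1 := Nat.lt_floor_add_one sP
      have hjn : j < n := by
        have : (j : ℝ) < n := hjs.trans_lt hsn
        exact_mod_cast this
      have hmj : m ≤ j := Nat.le_floor hs0
      have hjP : j < period h₀ := lt_of_lt_of_le hjn hn
      refine mem_iUnion₂.2 ⟨j, ⟨hmj, hjn⟩, ?_⟩
      have ht_eq : t = (j + (sP - j)) / period h₀ := by rw [hsP]; field_simp; ring
      rw [ht_eq, bdLoop_apply_div h₀ hjP ⟨by linarith, by linarith⟩, edgeSeg, segment_eq_image_lineMap]
      exact ⟨sP - j, ⟨by linarith, by linarith⟩, rfl⟩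
    · right
      exact hvertex n hn
  · rintro p (hp | hp)
    · rw [mem_iUnion₂] at hp
      obtain ⟨j, ⟨hmj, hjn⟩, hpj⟩ := hp
      have hjP : j < period h₀ := lt_of_lt_of_le hjn hn
      rw [edgeSeg, segment_eq_image_lineMap] at hpj
      obtain ⟨θ, hθ, rfl⟩ := hpj
      have hmj' : (m : ℝ) ≤ j := by exact_mod_cast hmj
      have hjn' : (j : ℝ) + 1 ≤ n := by exact_mod_cast hjn
      refine ⟨(j + θ) / period h₀, ⟨?_, ?_⟩, bdLoop_apply_div h₀ hjP hθ⟩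
      · exact div_le_div_of_nonneg_right (by linarith [hθ.1]) hP0.le
      · exact div_le_div_of_nonneg_right (by linarith [hθ.2]) hP0.le
    · rw [mem_singleton_iff] at hp
      subst hp
      exact ⟨n / period h₀, ⟨div_le_div_of_nonneg_right (by exact_mod_cast hmn) hP0.le, le_rfl⟩, hvertex n hn⟩

/-- **The arcs of the marked cell complex** are unions of traced edges: arc `k` consists of the
edges `a k ≤ j < a (k+1)` (with `a 4 = P`), together with the end vertex. [folklore] -/
theorem arc_cellRect (a : Fin 4 → ℕ) (ha0 : a 0 = 0) (hmono : StrictMono a) (ha3 : a 3 < period h₀)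
    (k : Fin 4) :
    (cellRect h₀ hP a hmono ha3).arc k =
      (⋃ j ∈ Ico (a k) (if h : (k : ℕ) + 1 < 4 then a ⟨k + 1, h⟩ else period h₀),
          edgeSeg (vert U d₀ j) (dirAt U d₀ j)) ∪
        {Site.toComplex (vert U d₀ (if h : (k : ℕ) + 1 < 4 then a ⟨k + 1, h⟩ else period h₀))} := by
  rw [MarkedDomain.arc]
  show bdLoop U d₀ h₀ '' Icc ((a k : ℝ) / period h₀) (MarkedDomain.nextMark _ k) = _
  unfold MarkedDomain.nextMark
  by_cases hk : (k : ℕ) + 1 < 4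
  · simp only [dif_pos hk]
    show bdLoop U d₀ h₀ '' Icc ((a k : ℝ) / period h₀) ((a ⟨k + 1, hk⟩ : ℝ) / period h₀) = _
    have hlt : a k < a ⟨k + 1, hk⟩ := hmono (Fin.lt_def.2 (by simp))
    have hle : a ⟨k + 1, hk⟩ ≤ a 3 := hmono.monotone (Fin.le_iff_val_le_val.2 (by simp only; omega))
    exact image_bdLoop_Icc h₀ hlt.le (hle.trans ha3.le)
  · simp only [dif_neg hk]
    show bdLoop U d₀ h₀ '' Icc ((a k : ℝ) / period h₀) ((a ⟨0, by omega⟩ : ℝ) / period h₀ + 1) = _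
    have hP0 : (0 : ℝ) < period h₀ := by exact_mod_cast period_pos h₀
    have h0 : ((a ⟨0, by omega⟩ : ℕ) : ℝ) / period h₀ + 1 = (period h₀ : ℝ) / period h₀ := by
      rw [show (⟨0, by omega⟩ : Fin 4) = 0 from rfl, ha0, Nat.cast_zero, zero_div, zero_add, div_self hP0.ne']
    rw [h0]
    have hk3 : a k ≤ a 3 := hmono.monotone (Fin.le_last k |>.trans_eq rfl)
    exact image_bdLoop_Icc h₀ (hk3.trans ha3.le) le_rfl

end Marked

/-! ### Quads from conformal rectangles through a square model -/

namespace SquareModelQuad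

open unitInterval

/-- The affine map of the unit square `I × I` onto `[-1, 1]²`. [folklore] -/
def sqPt (p : I × I) : ℂ := ((2 * (p.1 : ℝ) - 1 : ℝ) : ℂ) + ((2 * (p.2 : ℝ) - 1 : ℝ) : ℂ) * Complex.I

/-- Real part of `sqPt`. [folklore] -/
@[simp] theorem sqPt_re (p : I × I) : (sqPt p).re = 2 * (p.1 : ℝ) - 1 := by simp [sqPt]

/-- Imaginary part of `sqPt`. [folklore] -/
@[simp] theorem sqPt_im (p : I × I) : (sqPt p).im = 2 * (p.2 : ℝ) - 1 := by simp [sqPt]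

/-- `sqPt` is continuous. [folklore] -/
theorem continuous_sqPt : Continuous sqPt := by
  unfold sqPt
  fun_prop

/-- `sqPt` is injective. [folklore] -/
theorem sqPt_injective : Function.Injective sqPt := by
  intro p q h
  have h1 := congrArg Complex.re h
  have h2 := congrArg Complex.im h
  simp only [sqPt_re, sqPt_im] at h1 h2
  exact Prod.ext (Subtype.ext (by linarith)) (Subtype.ext (by linarith))

/-- The range of `sqPt` is the closed square `[-1,1]²`. [folklore] -/
theorem range_sqPt : range sqPt = Icc (-1 : ℝ) 1 ×ℂ Icc (-1 : ℝ) 1 := by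
  ext z
  simp only [mem_range, Complex.mem_reProdIm, mem_Icc]
  constructor
  · rintro ⟨p, rfl⟩
    simp only [sqPt_re, sqPt_im]
    have h1 := p.1.2.1; have h2 := p.1.2.2; have h3 := p.2.2.1; have h4 := p.2.2.2
    refine ⟨⟨by linarith, by linarith⟩, by linarith, by linarith⟩
  · rintro ⟨⟨h1, h2⟩, h3, h4⟩
    refine ⟨(⟨(z.re + 1) / 2, ⟨by linarith, by linarith⟩⟩, ⟨(z.im + 1) / 2, ⟨by linarith, by linarith⟩⟩), ?_⟩
    apply Complex.ext
    · rw [sqPt_re]; ring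
    · rw [sqPt_im]; ring

/-- The image of the side `p.1 = 0` is the left side of the square. [folklore] -/
theorem image_sqPt_fst_zero : sqPt '' {z | z.1 = 0} = {z | z.re = -1 ∧ z.im ∈ Icc (-1 : ℝ) 1} := by
  ext z; simp only [mem_image, mem_setOf_eq, mem_Icc]
  constructor
  · rintro ⟨p, hp, rfl⟩
    rw [sqPt_re, sqPt_im, hp]
    have h3 := p.2.2.1; have h4 := p.2.2.2
    exact ⟨by norm_num, by linarith, by linarith⟩
  · rintro ⟨h1, h2, h3⟩
    refine ⟨(0, ⟨(z.im + 1) / 2, ⟨by linarith, by linarith⟩⟩), rfl, ?_⟩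
    apply Complex.ext
    · rw [sqPt_re, h1]; norm_num
    · rw [sqPt_im]; ring

/-- The image of the side `p.1 = 1` is the right side of the square. [folklore] -/
theorem image_sqPt_fst_one : sqPt '' {z | z.1 = 1} = {z | z.re = 1 ∧ z.im ∈ Icc (-1 : ℝ) 1} := by
  ext z; simp only [mem_image, mem_setOf_eq, mem_Icc]
  constructor
  · rintro ⟨p, hp, rfl⟩
    rw [sqPt_re, sqPt_im, hp]
    have h3 := p.2.2.1; have h4 := p.2.2.2
    exact ⟨by norm_num, by linarith, by linarith⟩
  · rintro ⟨h1, h2, h3⟩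
    refine ⟨(1, ⟨(z.im + 1) / 2, ⟨by linarith, by linarith⟩⟩), rfl, ?_⟩
    apply Complex.ext
    · rw [sqPt_re, h1]; norm_num
    · rw [sqPt_im]; ring

/-- The image of the side `p.2 = 0` is the bottom side of the square. [folklore] -/
theorem image_sqPt_snd_zero : sqPt '' {z | z.2 = 0} = {z | z.im = -1 ∧ z.re ∈ Icc (-1 : ℝ) 1} := by
  ext z; simp only [mem_image, mem_setOf_eq, mem_Icc]
  constructor
  · rintro ⟨p, hp, rfl⟩
    rw [sqPt_re, sqPt_im, hp]
    have h1 := p.1.2.1; have h2 := p.1.2.2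
    exact ⟨by norm_num, by linarith, by linarith⟩
  · rintro ⟨h1, h2, h3⟩
    refine ⟨(⟨(z.re + 1) / 2, ⟨by linarith, by linarith⟩⟩, 0), rfl, ?_⟩
    apply Complex.ext
    · rw [sqPt_re]; ring
    · rw [sqPt_im, h1]; norm_num

/-- The image of the side `p.2 = 1` is the top side of the square. [folklore] -/
theorem image_sqPt_snd_one : sqPt '' {z | z.2 = 1} = {z | z.im = 1 ∧ z.re ∈ Icc (-1 : ℝ) 1} := by
  ext z; simp only [mem_image, mem_setOf_eq, mem_Icc]
  constructor
  · rintro ⟨p, hp, rfl⟩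
    rw [sqPt_re, sqPt_im, hp]
    have h1 := p.1.2.1; have h2 := p.1.2.2
    exact ⟨by norm_num, by linarith, by linarith⟩
  · rintro ⟨h1, h2, h3⟩
    refine ⟨(⟨(z.re + 1) / 2, ⟨by linarith, by linarith⟩⟩, 1), rfl, ?_⟩
    apply Complex.ext
    · rw [sqPt_re]; ring
    · rw [sqPt_im, h1]; norm_num

/-- The sides of the square as arcs of the model square: left `= arc 3`, bottom `= arc 0`,
right `= arc 1`, top `= arc 2`. [folklore] -/
theorem image_sqPt_eq_arc (k : Fin 4) :
    sqPt '' (match k with | 0 => {z | z.1 = 0} | 1 => {z | z.2 = 0} | 2 => {z | z.1 = 1} | 3 => {z | z.2 = 1}) =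
      unitSquareQuad.arc (k + 3) := by
  fin_cases k
  · show sqPt '' {z | z.1 = 0} = unitSquareQuad.arc 3
    rw [image_sqPt_fst_zero]; ext z
    rw [unitSquareQuad, mem_rectQuad_arc_three]; rfl
  · show sqPt '' {z | z.2 = 0} = unitSquareQuad.arc (1 + 3)
    rw [show (1 : Fin 4) + 3 = 0 from rfl, image_sqPt_snd_zero]; ext z
    rw [unitSquareQuad, mem_rectQuad_arc_zero]; rfl
  · show sqPt '' {z | z.1 = 1} = unitSquareQuad.arc (2 + 3)
    rw [show (2 : Fin 4) + 3 = 1 from rfl, image_sqPt_fst_one]; ext z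
    rw [unitSquareQuad, mem_rectQuad_arc_one]; rfl
  · show sqPt '' {z | z.2 = 1} = unitSquareQuad.arc (3 + 3)
    rw [show (3 : Fin 4) + 3 = 2 from rfl, image_sqPt_snd_one]; ext z
    rw [unitSquareQuad, mem_rectQuad_arc_two]; rfl

end SquareModelQuad

open SquareModelQuad in
/-- **A conformal rectangle read as a quad** through a square model `Φ` (Schoenflies): the map
`p ↦ Φ(2p - (1,1))` of the unit square. [cite: SchrammSmirnov2011, §1.3 and proof of Lemma 5.1] -/
def quadOfSquareModel {D : Set ℂ} (R : ConformalRectangle) (Φ : ℂ ≃ₜ ℂ) (hΦ : IsSquareModel R Φ)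
    (hD : closure R.carrier ⊆ D) : QuadCrossing.Quad D where
  toFun p := Φ (sqPt p)
  continuous_toFun := Φ.continuous.comp continuous_sqPt
  injective_toFun := Φ.injective.comp sqPt_injective
  range_subset := by
    rintro _ ⟨p, rfl⟩
    refine hD ?_
    rw [← hΦ.image_Icc, ← range_sqPt]
    exact ⟨sqPt p, ⟨p, rfl⟩, rfl⟩

open SquareModelQuad in
/-- The carrier of the quad of a square model is the closed domain. [folklore] -/
theorem carrier_quadOfSquareModel {D : Set ℂ} (R : ConformalRectangle) (Φ : ℂ ≃ₜ ℂ)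
    (hΦ : IsSquareModel R Φ) (hD : closure R.carrier ⊆ D) :
    (quadOfSquareModel R Φ hΦ hD).carrier = closure R.carrier := by
  show range (fun p => Φ (sqPt p)) = _
  rw [show (fun p => Φ (sqPt p)) = Φ ∘ sqPt from rfl, range_comp, range_sqPt, hΦ.image_Icc]

open SquareModelQuad in
/-- The sides of the quad of a square model are the arcs of the rectangle:
`side k = R.arc (k + 3)`. [folklore] -/
theorem side_quadOfSquareModel {D : Set ℂ} (R : ConformalRectangle) (Φ : ℂ ≃ₜ ℂ)
    (hΦ : IsSquareModel R Φ) (hD : closure R.carrier ⊆ D) (k : Fin 4) :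
    (quadOfSquareModel R Φ hΦ hD).side k = R.arc (k + 3) := by
  rw [← hΦ.image_arc (k + 3), ← image_sqPt_eq_arc k, ← image_comp]
  fin_cases k <;> rfl

/-- **Every conformal rectangle is a quad** of any domain containing its closure, with the same
closed carrier and `side k = arc (k + 3)`. [cite: SchrammSmirnov2011, §1.3] -/
theorem exists_quad_of_conformalRectangle {D : Set ℂ} (R : ConformalRectangle) (hD : closure R.carrier ⊆ D) :
    ∃ Q : QuadCrossing.Quad D, Q.carrier = closure R.carrier ∧ ∀ k, Q.side k = R.arc (k + 3) := by
  obtain ⟨Φ, hΦ⟩ := exists_isSquareModel R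
  exact ⟨quadOfSquareModel R Φ hΦ hD, carrier_quadOfSquareModel R Φ hΦ hD, side_quadOfSquareModel R Φ hΦ hD⟩

/-! ### The quad of a cell complex -/

section CellQuad

variable {U : Finset (Site 2)} {d₀ : Site 2 × Fin 4} (h₀ : IsBd U d₀) (hP : PinchFree U)

/-- **The quad of an edge-connected pinch-free hole-free cell complex** with four marked traced
vertices: carrier `K = ⋃ closed cells`, side `k` the traced edges from `a (k+3)` to `a (k+4)`
(indices of `a` mod `4`, `a 4 = P`). [cite: SchrammSmirnov2011, proof of Thm 1.5] -/
theorem exists_cellQuad {D : Set ℂ} (hE : EdgeConn U) (hH : CoHoleFree U) (a : Fin 4 → ℕ)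
    (hmono : StrictMono a) (ha3 : a 3 < period h₀) (hD : Kset U ⊆ D) :
    ∃ Q : QuadCrossing.Quad D, Q.carrier = Kset U ∧
      ∀ k, Q.side k = (cellRect h₀ hP a hmono ha3).arc (k + 3) := by
  have hcl : closure (cellRect h₀ hP a hmono ha3).carrier = Kset U :=
    closure_carrier_cellDomain h₀ hP hE hH
  obtain ⟨Q, hQ, hside⟩ := exists_quad_of_conformalRectangle (cellRect h₀ hP a hmono ha3) (hcl.symm ▸ hD)
  exact ⟨Q, hQ.trans hcl, hside⟩

end CellQuad

end CellComplex

end Literature.Probability.Percolation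

end
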